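import Summits.ResolutionOfSingularities.ResolutionOfSingularities.Theorems.FrobeniusLadderFInjectiveMacaulayficationOmegaExitBridge
import Summits.ResolutionOfSingularities.ResolutionOfSingularities.Theorems.FrobeniusLadderFInjectiveMacaulayficationOmegaOneCureFanCertStrong
import HarnessLib

/-!
# TASK 4c LIST BRIDGE, II (Ω₁ kernel row): one certified `exitOK'` entry ⇒ the NINE-WAY TAG DISJUNCTION of the master theorems, in `Finsupp` currency, at every `k`-point of the orbit
# (crux `FInjectiveMacaulayfication` stmt-ResolutionOfSingularities-15315, chain w45a; res-L1-w45a-plan-1 RULING R23.14 «stub-3 TAKES the LIST BRIDGE `checkExits' = true → per-pair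
# Finsupp hypotheses`», interface of record = res-L1-w45a-stub-1 g15 CHECKPOINT l.85877 (`exitOK'`, `isoLetter`, `checkExits'` of ✓ `…OmegaOneCureFanCertStrong`); the disjunction is
# the hypothesis `htag` of stub-1ʼs `PencilExitTagMaster.fullCl_pencilChartW_of_tag` / `…U_of_tag`, copied VERBATIM; seat res-L1-w45a-stub-3 g13)

[OURS · L1 W4.5a] Support file (`--supports stmt-ResolutionOfSingularities-15315 --as helper`); theorems only; no definitions, no named facts; field-free but for the letter `c : Fin n → k`.
Nothing of the crux is proved; no census row is asserted. AI-written (AI review is weaker than expert review).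

DICTIONARY (`Z = {i : c i = 0}` as a `List ℕ`, `hZ : c i = 0 ↔ ↑i ∈ Z`; the vectors `M₁ M₂ r s : Fin n →₀ ℕ` ARE the lists of `exitOK` entrywise): `rZ = true ↔ ∃ i, c i = 0 ∧ r i ≠ 0`,
`(rZ && sZ) = false ↔ ¬(… ∧ …)`, the third `nonpdiv` disjunct `↦ ∃ i, c i ≠ 0 ∧ 1 ≤ (r i − s i) + (s i − r i) ≤ 4`, `allLe (onZ Z M) b ↦ ∀ i, c i = 0 → M i ≤ b` (sums alike),
`isoLetter … false ↦ ∃ i, c i = 0 ∧ M₁ i ≠ 0 ∧ r i = 0`. ★★ `tag_of_exitOK'`: code `t` ↦ the `t`-th disjunct.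
[folklore bookkeeping; cite: Fedder1983, Thm. 1.12 (the criterion the disjunction feeds)]
-/

set_option linter.dupNamespace false

noncomputable section

namespace Summit.ResolutionOfSingularities.ResolutionOfSingularities.Theorems.FInjectiveMacaulayfication.OmegaExitTag

open Summit.ResolutionOfSingularities.ResolutionOfSingularities.Theorems.FInjectiveMacaulayfication
open FanCheckKit FanCheckSound OmegaOneCureFanCert OmegaOneCureFanCertStrong OmegaExitBridge

variable {k : Type} [Field k] {n : ℕ}

/-! ## §1 Three more dictionary entries -/

/-- The «some positive entry on `Z`» test, existential form. [plumbing] -/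
theorem any_onZ_pos_iff_exists (Z : List ℕ) (c : Fin n → k) (hZ : ∀ i : Fin n, c i = 0 ↔ (i : ℕ) ∈ Z) (hZn : ∀ j ∈ Z, j < n)
    (v : Fin n →₀ ℕ) (L : List ℕ) (hv : ∀ i : Fin n, v i = getL L i 0) :
    ((onZ Z L).any fun x => Nat.blt 0 x) = true ↔ ∃ i, c i = 0 ∧ v i ≠ 0 := by
  rw [any_onZ_pos_iff_not_forall Z c hZ hZn v L hv]
  constructor
  · intro h; push Not at h; exact h
  · rintro ⟨i, hci, hvi⟩ h; exact hvi (h i hci)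

/-- The third `nonpdiv` disjunct read on the vectors (ℕ-level). [plumbing] -/
theorem npd_of_any_offZ (Z : List ℕ) (c : Fin n → k) (hZ : ∀ i : Fin n, c i = 0 ↔ (i : ℕ) ∈ Z) (r s : Fin n →₀ ℕ) (Lr Ls : List ℕ)
    (hr : ∀ i : Fin n, r i = getL Lr i 0) (hs : ∀ i : Fin n, s i = getL Ls i 0)
    (h : (((List.range n).filter fun i => !(Z.any fun j => Nat.beq j i)).any fun i =>
      Nat.ble 1 ((getL Lr i 0 - getL Ls i 0) + (getL Ls i 0 - getL Lr i 0)) && Nat.ble ((getL Lr i 0 - getL Ls i 0) + (getL Ls i 0 - getL Lr i 0)) 4) = true) :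
    ∃ i, c i ≠ 0 ∧ 1 ≤ (r i - s i) + (s i - r i) ∧ (r i - s i) + (s i - r i) ≤ 4 := by
  obtain ⟨i₁, hi₁n, hi₁Z, hF⟩ := any_offZ n Z _ h
  rw [Bool.and_eq_true, Nat.ble_eq, Nat.ble_eq] at hF
  refine ⟨⟨i₁, hi₁n⟩, fun h0 => hi₁Z ((hZ _).1 h0), ?_⟩
  rw [hr, hs]
  exact hF

/-- The letter conjunct of ✓ `isoLetter` read on the vectors. [plumbing] -/
theorem letter_of_isoLetter (Z : List ℕ) (c : Fin n → k) (hZ : ∀ i : Fin n, c i = 0 ↔ (i : ℕ) ∈ Z) (hZn : ∀ j ∈ Z, j < n)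
    (M v : Fin n →₀ ℕ) (LM Lv : List ℕ) (hM : ∀ i : Fin n, M i = getL LM i 0) (hv : ∀ i : Fin n, v i = getL Lv i 0)
    (h : (Z.any fun i => Nat.blt 0 (getL LM i 0) && Nat.beq (getL Lv i 0) 0) = true) : ∃ i, c i = 0 ∧ M i ≠ 0 ∧ v i = 0 := by
  rw [List.any_eq_true] at h
  obtain ⟨j, hjZ, hj⟩ := h
  rw [Bool.and_eq_true, Nat.blt_eq, Nat.beq_eq] at hj
  exact exists_letter_of_onZ Z c hZ hZn M v LM Lv hM hv ⟨j, hjZ, Nat.pos_iff_ne_zero.1 hj.1, hj.2⟩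

/-! ## §2 ★★ The tag disjunction from one certified `exitOK'` entry -/

set_option maxHeartbeats 800000 in
-- nine-way case split
/-- ★★ **THE LIST BRIDGE**: if `exitOK' n e CI P Q rows Z t = true` (one entry of ✓ `checkExits'`, res-L1-w45a-stub-1 g15ʼs interface of record) and `M₁ M₂ r s : Fin n →₀ ℕ` are the exit
lists of the cone `rows` entrywise, then at every `c : Fin n → k` with `{i : c i = 0} = Z` the NINE-WAY TAG DISJUNCTION of the master theorems holds (code `t` gives the `t`-th
disjunct; the text below is the hypothesis `htag` of `PencilExitTagMaster.fullCl_pencilChartW_of_tag` verbatim). [OURS · TASK 4c list bridge] -/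
theorem tag_of_exitOK' (e CI : ℕ) (P Q : List ℕ) (rows : List (List ℕ)) (Z : List ℕ) (t : ℕ) (hok : exitOK' n e CI P Q rows Z t = true)
    (M₁ M₂ r s : Fin n →₀ ℕ)
    (hM₁ : ∀ i : Fin n, M₁ i = getL (vsub (rows.map fun ρ => e * getL ρ CI 0) (vmin (rows.map fun ρ => e * getL ρ CI 0) (vmin (rows.map fun ρ => dotL ρ P) (rows.map fun ρ => dotL ρ Q)))) i 0)
    (hM₂ : ∀ i : Fin n, M₂ i = getL (vsub (vmin (rows.map fun ρ => dotL ρ P) (rows.map fun ρ => dotL ρ Q))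
      (vmin (rows.map fun ρ => e * getL ρ CI 0) (vmin (rows.map fun ρ => dotL ρ P) (rows.map fun ρ => dotL ρ Q)))) i 0)
    (hr : ∀ i : Fin n, r i = getL (vsub (rows.map fun ρ => dotL ρ P) (vmin (rows.map fun ρ => dotL ρ P) (rows.map fun ρ => dotL ρ Q))) i 0)
    (hs : ∀ i : Fin n, s i = getL (vsub (rows.map fun ρ => dotL ρ Q) (vmin (rows.map fun ρ => dotL ρ P) (rows.map fun ρ => dotL ρ Q))) i 0)
    (c : Fin n → k) (hZ : ∀ i : Fin n, c i = 0 ↔ (i : ℕ) ∈ Z) (hZn : ∀ j ∈ Z, j < n) :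
    (∀ i, c i = 0 → M₁ i = 0) ∨
      (¬ ((∃ i, c i = 0 ∧ r i ≠ 0) ∧ (∃ i, c i = 0 ∧ s i ≠ 0)) ∧
        ((∃ i, c i = 0 ∧ r i ≠ 0) ∨ (∃ i, c i = 0 ∧ s i ≠ 0) ∨ (∃ i, c i ≠ 0 ∧ 1 ≤ (r i - s i) + (s i - r i) ∧ (r i - s i) + (s i - r i) ≤ 4)) ∧
        (∀ i, c i = 0 → M₂ i ≤ 1)) ∨
      (¬ ((∃ i, c i = 0 ∧ r i ≠ 0) ∧ (∃ i, c i = 0 ∧ s i ≠ 0)) ∧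
        ((∃ i, c i = 0 ∧ r i ≠ 0) ∨ (∃ i, c i = 0 ∧ s i ≠ 0) ∨ (∃ i, c i ≠ 0 ∧ 1 ≤ (r i - s i) + (s i - r i) ∧ (r i - s i) + (s i - r i) ≤ 4)) ∧
        (∀ i, c i = 0 → M₁ i ≤ 1)) ∨
      (¬ ((∃ i, c i = 0 ∧ r i ≠ 0) ∧ (∃ i, c i = 0 ∧ s i ≠ 0)) ∧
        ((∃ i, c i = 0 ∧ r i ≠ 0) ∨ (∃ i, c i = 0 ∧ s i ≠ 0) ∨ (∃ i, c i ≠ 0 ∧ 1 ≤ (r i - s i) + (s i - r i) ∧ (r i - s i) + (s i - r i) ≤ 4)) ∧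
        (∀ i, c i = 0 → M₁ i ≤ 2) ∧ (∀ i, c i = 0 → M₂ i ≤ 2)) ∨
      (((∃ i, c i = 0 ∧ r i ≠ 0) ∧ (∃ i, c i = 0 ∧ s i ≠ 0)) ∧ (∀ i, c i = 0 → M₁ i ≤ 1)) ∨
      (((∃ i, c i = 0 ∧ r i ≠ 0) ∧ (∃ i, c i = 0 ∧ s i ≠ 0)) ∧ (∀ i, c i = 0 → M₂ i + r i ≤ 1) ∧ (∃ i, c i = 0 ∧ M₁ i ≠ 0 ∧ r i = 0)) ∨
      (((∃ i, c i = 0 ∧ r i ≠ 0) ∧ (∃ i, c i = 0 ∧ s i ≠ 0)) ∧ (∀ i, c i = 0 → M₂ i + s i ≤ 1) ∧ (∃ i, c i = 0 ∧ M₁ i ≠ 0 ∧ s i = 0)) ∨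
      (((∃ i, c i = 0 ∧ r i ≠ 0) ∧ (∃ i, c i = 0 ∧ s i ≠ 0)) ∧ (∀ i, c i = 0 → M₁ i + M₂ i + r i ≤ 2)) ∨
      (((∃ i, c i = 0 ∧ r i ≠ 0) ∧ (∃ i, c i = 0 ∧ s i ≠ 0)) ∧ (∀ i, c i = 0 → M₁ i + M₂ i + s i ≤ 2)) := by
  have hok0 := exitOK_of_exitOK' n e CI P Q rows Z t hok
  -- the orbit tests
  have hrZ := any_onZ_pos_iff_exists Z c hZ hZn r _ hr
  have hsZ := any_onZ_pos_iff_exists Z c hZ hZn s _ hs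
  have hnd_of : ((((onZ Z (vsub (rows.map fun ρ => dotL ρ P) (vmin (rows.map fun ρ => dotL ρ P) (rows.map fun ρ => dotL ρ Q)))).any fun x => Nat.blt 0 x) &&
      ((onZ Z (vsub (rows.map fun ρ => dotL ρ Q) (vmin (rows.map fun ρ => dotL ρ P) (rows.map fun ρ => dotL ρ Q)))).any fun x => Nat.blt 0 x)) = false) →
      ¬ ((∃ i, c i = 0 ∧ r i ≠ 0) ∧ (∃ i, c i = 0 ∧ s i ≠ 0)) := fun hnd ⟨hR, hS⟩ => by
    rw [hrZ.2 hR, hsZ.2 hS] at hnd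
    exact Bool.noConfusion hnd
  have hnp_of : (((onZ Z (vsub (rows.map fun ρ => dotL ρ P) (vmin (rows.map fun ρ => dotL ρ P) (rows.map fun ρ => dotL ρ Q)))).any fun x => Nat.blt 0 x) = true ∨
      ((onZ Z (vsub (rows.map fun ρ => dotL ρ Q) (vmin (rows.map fun ρ => dotL ρ P) (rows.map fun ρ => dotL ρ Q)))).any fun x => Nat.blt 0 x) = true) ∨
      (((List.range n).filter fun i => !(Z.any fun j => Nat.beq j i)).any fun i =>
        Nat.ble 1 ((getL (vsub (rows.map fun ρ => dotL ρ P) (vmin (rows.map fun ρ => dotL ρ P) (rows.map fun ρ => dotL ρ Q))) i 0 -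
            getL (vsub (rows.map fun ρ => dotL ρ Q) (vmin (rows.map fun ρ => dotL ρ P) (rows.map fun ρ => dotL ρ Q))) i 0) +
          (getL (vsub (rows.map fun ρ => dotL ρ Q) (vmin (rows.map fun ρ => dotL ρ P) (rows.map fun ρ => dotL ρ Q))) i 0 -
            getL (vsub (rows.map fun ρ => dotL ρ P) (vmin (rows.map fun ρ => dotL ρ P) (rows.map fun ρ => dotL ρ Q))) i 0)) &&
        Nat.ble ((getL (vsub (rows.map fun ρ => dotL ρ P) (vmin (rows.map fun ρ => dotL ρ P) (rows.map fun ρ => dotL ρ Q))) i 0 -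
            getL (vsub (rows.map fun ρ => dotL ρ Q) (vmin (rows.map fun ρ => dotL ρ P) (rows.map fun ρ => dotL ρ Q))) i 0) +
          (getL (vsub (rows.map fun ρ => dotL ρ Q) (vmin (rows.map fun ρ => dotL ρ P) (rows.map fun ρ => dotL ρ Q))) i 0 -
            getL (vsub (rows.map fun ρ => dotL ρ P) (vmin (rows.map fun ρ => dotL ρ P) (rows.map fun ρ => dotL ρ Q))) i 0)) 4) = true →
      (∃ i, c i = 0 ∧ r i ≠ 0) ∨ (∃ i, c i = 0 ∧ s i ≠ 0) ∨ (∃ i, c i ≠ 0 ∧ 1 ≤ (r i - s i) + (s i - r i) ∧ (r i - s i) + (s i - r i) ≤ 4) := fun hnp => by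
    rcases hnp with (h | h) | h
    · exact Or.inl (hrZ.1 h)
    · exact Or.inr (Or.inl (hsZ.1 h))
    · exact Or.inr (Or.inr (npd_of_any_offZ Z c hZ r s _ _ hr hs h))
  have hdeep_of : (((onZ Z (vsub (rows.map fun ρ => dotL ρ P) (vmin (rows.map fun ρ => dotL ρ P) (rows.map fun ρ => dotL ρ Q)))).any fun x => Nat.blt 0 x) = true ∧
      ((onZ Z (vsub (rows.map fun ρ => dotL ρ Q) (vmin (rows.map fun ρ => dotL ρ P) (rows.map fun ρ => dotL ρ Q)))).any fun x => Nat.blt 0 x) = true) →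
      (∃ i, c i = 0 ∧ r i ≠ 0) ∧ (∃ i, c i = 0 ∧ s i ≠ 0) := fun h => ⟨hrZ.1 h.1, hsZ.1 h.2⟩
  -- nine codes
  have ht9 := exitOK_lt_nine n e CI P Q rows Z t hok0
  interval_cases t
  · -- code 0
    simp only [exitOK] at hok0
    exact Or.inl fun i hci => Nat.le_zero.1 (le_of_allLe_onZ Z c hZ M₁ _ hM₁ 0 hok0 i hci)
  · -- code 1
    simp only [exitOK, Bool.and_eq_true, Bool.not_eq_true', Bool.or_eq_true] at hok0
    obtain ⟨⟨hnd, hnp⟩, hb⟩ := hok0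
    exact Or.inr (Or.inl ⟨hnd_of hnd, hnp_of hnp, le_of_allLe_onZ Z c hZ M₂ _ hM₂ 1 hb⟩)
  · -- code 2
    simp only [exitOK, Bool.and_eq_true, Bool.not_eq_true', Bool.or_eq_true] at hok0
    obtain ⟨⟨hnd, hnp⟩, hb⟩ := hok0
    exact Or.inr (Or.inr (Or.inl ⟨hnd_of hnd, hnp_of hnp, le_of_allLe_onZ Z c hZ M₁ _ hM₁ 1 hb⟩))
  · -- code 3
    simp only [exitOK, Bool.and_eq_true, Bool.not_eq_true', Bool.or_eq_true] at hok0
    obtain ⟨⟨⟨hnd, hnp⟩, hb1⟩, hb2⟩ := hok0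
    exact Or.inr (Or.inr (Or.inr (Or.inl ⟨hnd_of hnd, hnp_of hnp, le_of_allLe_onZ Z c hZ M₁ _ hM₁ 2 hb1, le_of_allLe_onZ Z c hZ M₂ _ hM₂ 2 hb2⟩)))
  · -- code 4
    simp only [exitOK, Bool.and_eq_true] at hok0
    obtain ⟨hdp, hb⟩ := hok0
    exact Or.inr (Or.inr (Or.inr (Or.inr (Or.inl ⟨hdeep_of hdp, le_of_allLe_onZ Z c hZ M₁ _ hM₁ 1 hb⟩))))
  · -- code 5, with the letter conjunct of `exitOK'`
    have hiso := isoLetter_of_exitOK'_five n e CI P Q rows Z hok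
    simp only [isoLetter, Bool.false_eq_true] at hiso
    simp only [exitOK, Bool.and_eq_true] at hok0
    obtain ⟨hdp, hb⟩ := hok0
    exact Or.inr (Or.inr (Or.inr (Or.inr (Or.inr (Or.inl ⟨hdeep_of hdp, add_le_of_allLe_onZ Z c hZ M₂ r _ _ hM₂ hr 1 hb,
      letter_of_isoLetter Z c hZ hZn M₁ r _ _ hM₁ hr hiso⟩)))))
  · -- code 6, with the letter conjunct of `exitOK'`
    have hiso := isoLetter_of_exitOK'_six n e CI P Q rows Z hok
    simp only [isoLetter] at hiso
    simp only [exitOK, Bool.and_eq_true] at hok0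
    obtain ⟨hdp, hb⟩ := hok0
    exact Or.inr (Or.inr (Or.inr (Or.inr (Or.inr (Or.inr (Or.inl ⟨hdeep_of hdp, add_le_of_allLe_onZ Z c hZ M₂ s _ _ hM₂ hs 1 hb,
      letter_of_isoLetter Z c hZ hZn M₁ s _ _ hM₁ hs hiso⟩))))))
  · -- code 7
    simp only [exitOK, Bool.and_eq_true] at hok0
    obtain ⟨hdp, hb⟩ := hok0
    exact Or.inr (Or.inr (Or.inr (Or.inr (Or.inr (Or.inr (Or.inr (Or.inl ⟨hdeep_of hdp, add_add_le_of_allLe_onZ Z c hZ M₁ M₂ r _ _ _ hM₁ hM₂ hr 2 hb⟩)))))))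
  · -- code 8
    simp only [exitOK, Bool.and_eq_true] at hok0
    obtain ⟨hdp, hb⟩ := hok0
    exact Or.inr (Or.inr (Or.inr (Or.inr (Or.inr (Or.inr (Or.inr (Or.inr ⟨hdeep_of hdp, add_add_le_of_allLe_onZ Z c hZ M₁ M₂ s _ _ _ hM₁ hM₂ hs 2 hb⟩)))))))

end Summit.ResolutionOfSingularities.ResolutionOfSingularities.Theorems.FInjectiveMacaulayfication.OmegaExitTag

end
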